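import Summits.QuantumFields.YangMills.Theorems.BalabanUVNodesN15KingModelAnalyticDeterminantSylvester
import Summits.QuantumFields.YangMills.Theorems.BalabanUVNodesN15KingModelAnalyticBlockCovRealSlice
import Summits.QuantumFields.YangMills.Theorems.BalabanUVNodesN15KingModelFreeRGGaussNorm
import Literature.MathematicalPhysics.QuantumFieldTheory.Balaban1983to89.Beta.GaussianIntegral
import HarnessLib

/-!
# BalabanUVNodes ∕ N15 — THE KING-MODEL RUNG (PART Ϭ-b): THE BLOCK-FIELD NORMALISATION ON THE REAL SLICE — `(am²∕(a+m²))^{N} ≤ det Δ_eff(U) ≤ a^{N}` AT EVERY UNITARY BACKGROUND,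
# hence the block-field vacuum energy per degree of freedom `N⁻¹·ln det Δ_eff(U)` lives in `[ln(am²∕(a+m²)), ln a]` and MOVES BY AT MOST `ln(1 + a∕m²)` between ANY two backgrounds (η-uniform,
# no window, no curvature hypothesis); King's (3.89) «`ln N = −½ ln det Δ + const`» LITERALLY for `Δ_eff(U)` at every real-orthogonal background, with `|ln 𝒩(Δ_eff(U)) − ln 𝒩(Δ_eff(V))| ≤ ½N·ln(1+a∕m²)`;
# King's `ln[Z(U)Z(V)⁻¹]` differs from the diamagnetic fine shift by at most `N·ln(1+a∕m²)` (PART Ϭ-a's split)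
# (Track A, DAG node N15 = NE2; FAN-OUT v1.1 §N15 s3 «KING-MODEL RUNG … + what the curved case adds»; count-neutral)

HONEST FRAMING.  Count-neutral (cell `pub-ymgap`, seat `pub-ymgap-dag-n15-e` g53; `--supports stmt-QuantumFields-27247 --as helper` = K3ᴬ, KEY MAP v3).  King's one-level comparison model on
the real slice (unitary backgrounds), massive fine covariance `m² > 0`, `a > 0`, `c ≥ 0`; spectral bookkeeping (`det = Π` eigenvalues) on top of PART Ϫ-l's spectrum `[(a⁻¹+m⁻²)⁻¹, a]`; the edges
are the sharp spectral edges (the floor eigenvalue is attained on the zero mode at `U ≡ 1`, Ϫ-j), the determinant bounds themselves are not claimed attained; the Gaussian-integral form (§3) at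
`𝕜 = ℝ` (real-orthogonal link fields).  NOT Bałaban's multi-level normalisations; NOT a node discharge (N15 of record untouched); nothing continuum ∕ ℝ⁴ ∕ OS ∕ Clay.

THE RESULTS (unitary `U`, `a, m² > 0`, `c ≥ 0`, `N = |T₁|·|n|`):
* §1 `re_det_effLapU_eq_prod_eigenvalues`, ★★ `posDef_effLapU` (Ϫ-l's sharp floor as a coercivity constant), ★★★ **`pow_le_re_det_effLapU`** (`(a⁻¹+m⁻²)^{−N} ≤ det Δ_eff(U)`),
  ★★★ **`re_det_effLapU_le_pow`** (`det Δ_eff(U) ≤ a^{N}`), ★★★ **`log_re_det_effLapU_div_mem_Icc`** (nonempty fibre: `N⁻¹ln det Δ_eff(U) ∈ [−ln(a⁻¹+m⁻²), ln a]`),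
  ★★★★ **`abs_log_re_det_effLapU_sub_le`** (ANY two unitary `U, V`: `|ln det Δ_eff(U) − ln det Δ_eff(V)| ≤ N·ln(1+a∕m²)` — per degree of freedom `N⁻¹·ln det Δ_eff` moves by at most `ln(1+a∕m²)` (so King's `E₀ = ln 𝒩 = const − ½ln det` moves by at most `½ln(1+a∕m²)` per dof, §2)
  between any two backgrounds, uniformly in the spacing, the volume, the fibre and the contour system), ★★★ **`abs_king_logZ_sub_fineShift_le`** (King's `ln[Z(U)Z(V)⁻¹] = ln det A₀(U) − ln det A₀(V)`
  differs from the diamagnetic fine shift `ln det B(U) − ln det B(V)` by at most `N·ln(1+a∕m²)` — Ϭ-a's split).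
* §2 `𝕜 = ℝ` (real-orthogonal backgrounds): ★★★ **`gaussNorm_effLapU_eq`** (`𝒩(Δ_eff(U)) = ∫e^{−½⟨ψ,Δ_eff(U)ψ⟩}dψ = √(2π)^{N}∕√det Δ_eff(U)` — King's (2.6)∕(3.89) normalisation of the block-field
  Gaussian AT A CURVED BACKGROUND, PART Τ's `gaussNorm`), ★★★ **`log_gaussNorm_effLapU`** (`ln 𝒩 = ½N·ln 2π − ½ln det Δ_eff(U)` — (3.89) literally), ★★ `log_gaussNorm_effLapU_mem_Icc`,
  ★★★ **`abs_log_gaussNorm_effLapU_sub_le`** (`|ln 𝒩(Δ_eff(U)) − ln 𝒩(Δ_eff(V))| ≤ ½N·ln(1+a∕m²)`).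
PRIOR TREE ART (by name): Ϫ-l (`isHermitian_effLapU`, `eigenvalues_effLapU_mem_Icc`, `re_quadForm_effLapU_ge_sharp`), Ϭ-a (`re_det_effLapU_pos`, `king_logZ_split`), Ϡ-i (`posDef_of_coercive'`),
Ͱ-b (`sum_norm_fib_sq`), Τ-a (`gaussNorm`), BETA cell `GaussianIntegral` (`integral_exp_neg_half_quadForm`, `log_integral_exp_neg_half_quadForm`), Ε-p (`gaussNorm_eq_det` — the `U ≡ 1`∕generic
coercive form, cited), Mathlib (`Matrix.IsHermitian.det_eq_prod_eigenvalues`, `Finset.prod_le_prod`).  Dedup (rg at filing): basename 0 files; needles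
`pow_le_re_det_effLapU|re_det_effLapU_le_pow|abs_log_re_det_effLapU_sub_le|gaussNorm_effLapU_eq|posDef_effLapU` 0 tree files.  Locators: [King1986] (2.6) p.652, (2.14) p.653, (3.89) p.668, (3.90) p.669,
(4.33) p.674; [Balaban1985BackgroundPropagators] (3.25) p.394; [HornJohnson2013] Thm 4.2.2 (c) p.234.  0 `sorry`, 0 `def`.  v1.1 (DOC-ONLY, ERRATUM-Ϭ2, ref-I READ-1092 N1): ONE convention —
`N⁻¹·ln det Δ_eff` moves by `≤ ln(1+a∕m²)`, King's `E₀ = ln 𝒩` by `≤ ½ln(1+a∕m²)` per dof (v1.0's header l.22 glossed the `ln det` theorem with the `½`); declarations byte-identical.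
-/

noncomputable section
open scoped BigOperators ComplexConjugate ComplexOrder Matrix.Norms.L2Operator
open Finset Matrix WithLp MeasureTheory

namespace Summit.QuantumFields.YangMills.BalabanUVNodes.N15KingModelRung.Analytic

open Literature.MathematicalPhysics.QuantumFieldTheory.Balaban1983to89.B5Prop11Plancherel (Tor fine)
open Literature.MathematicalPhysics.QuantumFieldTheory.Balaban1983to89.Beta.GaussianIntegral (integral_exp_neg_half_quadForm log_integral_exp_neg_half_quadForm)
open Summit.QuantumFields.YangMills.BalabanUVNodes.N15KingModelRung.Covariant (covLapF sum_norm_fib_sq)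
open Summit.QuantumFields.YangMills.BalabanUVNodes.N15KingModelRung.CovariantBlock (BlockTree fullOpU effLapU)
open Summit.QuantumFields.YangMills.BalabanUVNodes.N15KingModelRung.Landau (posDef_of_coercive')
open Summit.QuantumFields.YangMills.BalabanUVNodes.N15KingModelRung.FreeField (gaussNorm)

variable {d : ℕ} {L : ℕ} [NeZero L] (T : BlockTree d L) (M : Fin (d + 1) → ℕ) [hM : ∀ μ, NeZero (M μ)]

/-! ## §1 `det Δ_eff(U)` as the product of PART Ϫ-l's eigenvalues: the sharp two-sided bound and the η-uniform shift -/

section Spectral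

variable {𝕜 : Type*} [RCLike 𝕜] {n : Type*} [Fintype n] [DecidableEq n]
variable {a c m2 : ℝ} (ha : 0 < a) (hc : 0 ≤ c) (hm : 0 < m2) {U : Tor (fine L M) × Fin (d + 1) → Matrix n n 𝕜} (hU : ∀ bd, U bd ∈ Matrix.unitaryGroup n 𝕜)
include ha hc hm hU

/-- `Re det Δ_eff(U) = Π_p λ_p(Δ_eff(U))` over PART Ϫ-l's eigenvalues. [cite: King1986, (2.14) p.653, (3.89) p.668; HornJohnson2013, Thm 4.2.2 (c) p.234] -/
theorem re_det_effLapU_eq_prod_eigenvalues : RCLike.re (effLapU T M a c m2 U).det = ∏ p, (isHermitian_effLapU T M ha hc hm hU).eigenvalues p := by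
  rw [(isHermitian_effLapU T M ha hc hm hU).det_eq_prod_eigenvalues, ← RCLike.ofReal_prod, RCLike.ofReal_re]

/-- ★★ **`Δ_eff(U)` IS POSITIVE DEFINITE** at every unitary background, with PART Ϫ-l's sharp floor `(a⁻¹+m⁻²)⁻¹` as coercivity constant (nonempty fibre).
[cite: King1986, (2.14) p.653, (4.33) p.674; Balaban1985BackgroundPropagators, (3.25) p.394] -/
theorem posDef_effLapU [Nonempty n] : (effLapU T M a c m2 U).PosDef :=
  posDef_of_coercive' M (isHermitian_effLapU T M ha hc hm hU) (κ := (a⁻¹ + m2⁻¹)⁻¹) (by positivity)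
    (fun v => by rw [sum_norm_fib_sq, EuclideanSpace.norm_sq_eq]; exact re_quadForm_effLapU_ge_sharp T M ha hc hm hU v)

/-- ★★★ **THE FLOOR**: `(a⁻¹+m⁻²)^{−N} ≤ det Δ_eff(U)` — every eigenvalue is at least the series mass `am²∕(a+m²)` (PART Ϫ-l). [cite: King1986, (2.14) p.653, (3.89) p.668, (4.33) p.674; HornJohnson2013, Thm 4.2.2 (c) p.234] -/
theorem pow_le_re_det_effLapU : (a⁻¹ + m2⁻¹)⁻¹ ^ Fintype.card (Tor M × n) ≤ RCLike.re (effLapU T M a c m2 U).det := by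
  rw [re_det_effLapU_eq_prod_eigenvalues T M ha hc hm hU, ← Finset.card_univ, ← Finset.prod_const]
  exact Finset.prod_le_prod (fun _ _ => by positivity) fun p _ => (eigenvalues_effLapU_mem_Icc T M ha hc hm hU p).1

/-- ★★★ **THE CEILING**: `det Δ_eff(U) ≤ a^{N}` — every eigenvalue is at most the block coupling `a` (PART Ϫ-l). [cite: King1986, (2.14) p.653, (3.89) p.668; HornJohnson2013, Thm 4.2.2 (c) p.234] -/
theorem re_det_effLapU_le_pow : RCLike.re (effLapU T M a c m2 U).det ≤ a ^ Fintype.card (Tor M × n) := by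
  rw [re_det_effLapU_eq_prod_eigenvalues T M ha hc hm hU, ← Finset.card_univ, ← Finset.prod_const]
  have hβ : 0 < (a⁻¹ + m2⁻¹)⁻¹ := by positivity
  exact Finset.prod_le_prod (fun p _ => (hβ.le.trans (eigenvalues_effLapU_mem_Icc T M ha hc hm hU p).1)) fun p _ => (eigenvalues_effLapU_mem_Icc T M ha hc hm hU p).2

/-- ★★★ **THE BLOCK-FIELD VACUUM ENERGY PER DEGREE OF FREEDOM** `N⁻¹·ln det Δ_eff(U)` lies in `[−ln(a⁻¹+m⁻²), ln a] = [ln(am²∕(a+m²)), ln a]` at EVERY unitary background (nonempty fibre) —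
uniformly in the spacing, the volume, the fibre and the contour system. [cite: King1986, (2.6) p.652, (3.89) p.668, (4.33) p.674] -/
theorem log_re_det_effLapU_div_mem_Icc [Nonempty n] :
    Real.log (RCLike.re (effLapU T M a c m2 U).det) / Fintype.card (Tor M × n) ∈ Set.Icc (-Real.log (a⁻¹ + m2⁻¹)) (Real.log a) := by
  have hN : (0 : ℝ) < Fintype.card (Tor M × n) := by exact_mod_cast Fintype.card_pos
  have hβ : 0 < (a⁻¹ + m2⁻¹)⁻¹ := by positivity
  have hlo := pow_le_re_det_effLapU T M ha hc hm hU
  have hhi := re_det_effLapU_le_pow T M ha hc hm hU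
  have hpos : 0 < (a⁻¹ + m2⁻¹)⁻¹ ^ Fintype.card (Tor M × n) := pow_pos hβ _
  constructor
  · rw [le_div_iff₀ hN, ← Real.log_inv, mul_comm, ← Real.log_pow]
    exact Real.log_le_log hpos hlo
  · rw [div_le_iff₀ hN, mul_comm, ← Real.log_pow]
    exact Real.log_le_log (hpos.trans_le hlo) hhi

omit hU in
/-- ★★★★ **THE BLOCK-FIELD NORMALISATION MOVES BY AT MOST `N·ln(1+a∕m²)` BETWEEN ANY TWO BACKGROUNDS**: for all unitary `U, V`,
`|ln det Δ_eff(U) − ln det Δ_eff(V)| ≤ N·ln(1 + a∕m²)` (both logarithms lie in an interval of that length: `ln a + ln(a⁻¹+m⁻²) = ln(1+a∕m²)`) — η-uniform, no window, no curvature hypothesis.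
[cite: King1986, (2.6) p.652, (3.89)–(3.90) pp.668–669, (4.33) p.674] -/
theorem abs_log_re_det_effLapU_sub_le {U V : Tor (fine L M) × Fin (d + 1) → Matrix n n 𝕜} (hU : ∀ bd, U bd ∈ Matrix.unitaryGroup n 𝕜) (hV : ∀ bd, V bd ∈ Matrix.unitaryGroup n 𝕜) :
    |Real.log (RCLike.re (effLapU T M a c m2 U).det) - Real.log (RCLike.re (effLapU T M a c m2 V).det)| ≤ Fintype.card (Tor M × n) * Real.log (1 + a / m2) := by
  have hβ : 0 < (a⁻¹ + m2⁻¹)⁻¹ := by positivity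
  have key : ∀ {W : Tor (fine L M) × Fin (d + 1) → Matrix n n 𝕜}, (∀ bd, W bd ∈ Matrix.unitaryGroup n 𝕜) →
      Fintype.card (Tor M × n) * Real.log ((a⁻¹ + m2⁻¹)⁻¹) ≤ Real.log (RCLike.re (effLapU T M a c m2 W).det)
        ∧ Real.log (RCLike.re (effLapU T M a c m2 W).det) ≤ Fintype.card (Tor M × n) * Real.log a := by
    intro W hW
    have hlo := pow_le_re_det_effLapU T M ha hc hm hW
    have hhi := re_det_effLapU_le_pow T M ha hc hm hW
    have hpos : 0 < (a⁻¹ + m2⁻¹)⁻¹ ^ Fintype.card (Tor M × n) := pow_pos hβ _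
    refine ⟨?_, ?_⟩
    · rw [← Real.log_pow]; exact Real.log_le_log hpos hlo
    · rw [← Real.log_pow]; exact Real.log_le_log (hpos.trans_le hlo) hhi
  have hlen : Real.log a - Real.log ((a⁻¹ + m2⁻¹)⁻¹) = Real.log (1 + a / m2) := by
    rw [Real.log_inv, sub_neg_eq_add, ← Real.log_mul ha.ne' (by positivity)]
    congr 1
    field_simp
  obtain ⟨hU1, hU2⟩ := key hU
  obtain ⟨hV1, hV2⟩ := key hV
  rw [abs_sub_le_iff]
  constructor <;> nlinarith [hlen]

omit hU in
/-- ★★★ **KING's `ln[Z(U)Z(V)⁻¹]` IS THE DIAMAGNETIC FINE SHIFT UP TO A BOUNDED BLOCK TERM**: for all unitary `U, V`,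
`|[ln det A₀(U) − ln det A₀(V)] − [ln det(−cΔ_U+m²) − ln det(−cΔ_V+m²)]| ≤ N·ln(1+a∕m²)` (PART Ϭ-a's split plus the shift bound). [cite: King1986, (3.89)–(3.90) pp.668–669, (3.94) p.669] -/
theorem abs_king_logZ_sub_fineShift_le {U V : Tor (fine L M) × Fin (d + 1) → Matrix n n 𝕜} (hU : ∀ bd, U bd ∈ Matrix.unitaryGroup n 𝕜) (hV : ∀ bd, V bd ∈ Matrix.unitaryGroup n 𝕜) :
    |(Real.log (RCLike.re (fullOpU T M a c m2 U).det) - Real.log (RCLike.re (fullOpU T M a c m2 V).det))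
        - (Real.log (RCLike.re (covLapF (fine L M) c m2 U).det) - Real.log (RCLike.re (covLapF (fine L M) c m2 V).det))|
      ≤ Fintype.card (Tor M × n) * Real.log (1 + a / m2) := by
  rw [king_logZ_split T M ha hc hm hU hV, sub_sub_cancel_left, abs_neg]
  exact abs_log_re_det_effLapU_sub_le T M ha hc hm hU hV

end Spectral

/-! ## §2 King's (3.89) literally: the block-field Gaussian normalisation at a curved (real-orthogonal) background -/

section GaussNorm

variable {n : Type*} [Fintype n] [DecidableEq n] [Nonempty n]
variable {a c m2 : ℝ} (ha : 0 < a) (hc : 0 ≤ c) (hm : 0 < m2) {U : Tor (fine L M) × Fin (d + 1) → Matrix n n ℝ} (hU : ∀ bd, U bd ∈ Matrix.unitaryGroup n ℝ)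
include ha hc hm hU

/-- ★★★ **`𝒩(Δ_eff(U)) = ∫e^{−½⟨ψ,Δ_eff(U)ψ⟩}dψ = √(2π)^{N}∕√(det Δ_eff(U))`** at every real-orthogonal background (PART Τ's `gaussNorm`, the BETA cell's Gaussian integral).
[cite: King1986, (2.6) p.652, (3.89) p.668] -/
theorem gaussNorm_effLapU_eq : gaussNorm (effLapU T M a c m2 U) = Real.sqrt (2 * Real.pi) ^ Fintype.card (Tor M × n) / Real.sqrt (effLapU T M a c m2 U).det :=
  integral_exp_neg_half_quadForm _ (posDef_effLapU T M ha hc hm hU)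

/-- ★★★ **KING's (3.89) LITERALLY AT A CURVED BACKGROUND**: `ln 𝒩(Δ_eff(U)) = ½N·ln 2π − ½·ln det Δ_eff(U)`. [cite: King1986, (3.89) p.668, (2.6) p.652] -/
theorem log_gaussNorm_effLapU :
    Real.log (gaussNorm (effLapU T M a c m2 U)) = (Fintype.card (Tor M × n) : ℝ) / 2 * Real.log (2 * Real.pi) - 1 / 2 * Real.log (effLapU T M a c m2 U).det :=
  log_integral_exp_neg_half_quadForm _ (posDef_effLapU T M ha hc hm hU)

/-- ★★ `ln 𝒩(Δ_eff(U)) − ½N·ln 2π ∈ [−½N·ln a, ½N·ln(a⁻¹+m⁻²)]` at every real-orthogonal background. [cite: King1986, (3.89) p.668, (4.33) p.674] -/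
theorem log_gaussNorm_effLapU_mem_Icc :
    Real.log (gaussNorm (effLapU T M a c m2 U)) - (Fintype.card (Tor M × n) : ℝ) / 2 * Real.log (2 * Real.pi)
      ∈ Set.Icc (-(Fintype.card (Tor M × n) : ℝ) / 2 * Real.log a) ((Fintype.card (Tor M × n) : ℝ) / 2 * Real.log (a⁻¹ + m2⁻¹)) := by
  have hN : (0 : ℝ) < Fintype.card (Tor M × n) := by exact_mod_cast Fintype.card_pos
  have h := log_re_det_effLapU_div_mem_Icc T M ha hc hm hU
  rw [RCLike.re_to_real] at h
  obtain ⟨h1, h2⟩ := h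
  rw [le_div_iff₀ hN] at h1
  rw [div_le_iff₀ hN] at h2
  rw [log_gaussNorm_effLapU T M ha hc hm hU]
  constructor <;> nlinarith

omit hU in
/-- ★★★ **`|ln 𝒩(Δ_eff(U)) − ln 𝒩(Δ_eff(V))| ≤ ½N·ln(1+a∕m²)`** for any two real-orthogonal backgrounds — the block-field normalisation of King's RG step is η-uniformly stable under changes
of the background. [cite: King1986, (3.89)–(3.90) pp.668–669, (3.93) p.669] -/
theorem abs_log_gaussNorm_effLapU_sub_le {U V : Tor (fine L M) × Fin (d + 1) → Matrix n n ℝ} (hU : ∀ bd, U bd ∈ Matrix.unitaryGroup n ℝ) (hV : ∀ bd, V bd ∈ Matrix.unitaryGroup n ℝ) :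
    |Real.log (gaussNorm (effLapU T M a c m2 U)) - Real.log (gaussNorm (effLapU T M a c m2 V))| ≤ (Fintype.card (Tor M × n) : ℝ) / 2 * Real.log (1 + a / m2) := by
  have h := abs_log_re_det_effLapU_sub_le T M ha hc hm hU hV
  simp only [RCLike.re_to_real] at h
  rw [log_gaussNorm_effLapU T M ha hc hm hU, log_gaussNorm_effLapU T M ha hc hm hV]
  rw [show (Fintype.card (Tor M × n) : ℝ) / 2 * Real.log (2 * Real.pi) - 1 / 2 * Real.log (effLapU T M a c m2 U).det
      - ((Fintype.card (Tor M × n) : ℝ) / 2 * Real.log (2 * Real.pi) - 1 / 2 * Real.log (effLapU T M a c m2 V).det)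
      = -(1 / 2) * (Real.log (effLapU T M a c m2 U).det - Real.log (effLapU T M a c m2 V).det) by ring, abs_mul, abs_neg,
    abs_of_pos (by norm_num : (0 : ℝ) < 1 / 2)]
  nlinarith

end GaussNorm

end Summit.QuantumFields.YangMills.BalabanUVNodes.N15KingModelRung.Analytic

end
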